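import Mathlib.Algebra.Order.BigOperators.Group.Finset
import Mathlib.Algebra.BigOperators.Ring.Finset
import Mathlib.Data.Real.Basic
import HarnessLib

/-!
# The scale-band pigeonhole of `textureBuild` (finite counting form)

HONEST FRAMING. Part of the venture `Summits/Ventures/Crystal3D` (cell `crystal3d-full`), helper for the
crux `TextureLiminf` (stmt-Ventures-19483) of `route-Ventures-StickyWulffConstant`, line `TexShadow`, item n1
of the coordinator (shape-independent sub-lemmas of `textureBuild`), step (L-band) of §73.9 of the planner's
route notes: the area increments of the fitted surfaces over `m` octave bands of scales are carried by
pairwise disjoint sets `A j` of defective balls, all inside the defective set `D`; hence ONE band carries at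
most `#D / m` of them (or at most `W / m` of any nonnegative weight of total `W` on `D`), and that band's scale
is the working scale of the cell census.  Pure pigeonhole; nothing about packings.

**Theorems.** `exists_band_card_le`: `s` a nonempty finite set of bands, `A j ⊆ D` pairwise disjoint for
`j ∈ s` ⇒ `∃ j ∈ s, #(A j) ≤ #D / #s`.  `exists_band_weight_le`: the same with a weight `w ≥ 0` on `D`:
`∃ j ∈ s, Σ_{A j} w ≤ (Σ_D w) / #s`.

WHAT THIS IS NOT: the definition of the bands (dyadic scales of the local flatness radius) and the census
are elsewhere.
-/

namespace Summit.Ventures.Crystal3D.Theorems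

open Finset

/-- **Band pigeonhole, counting form.**  If the finite sets `A j`, `j ∈ s` (`s` nonempty), are pairwise
disjoint subsets of `D`, some `A j` has at most `#D / #s` elements. -/
theorem exists_band_card_le {β ι : Type*} [DecidableEq ι] (s : Finset β) (hs : s.Nonempty)
    (D : Finset ι) (A : β → Finset ι) (hsub : ∀ j ∈ s, A j ⊆ D)
    (hdisj : (s : Set β).PairwiseDisjoint A) :
    ∃ j ∈ s, ((A j).card : ℝ) ≤ D.card / s.card := by
  have hspos : (0 : ℝ) < s.card := by exact_mod_cast hs.card_pos
  have hsum : ∑ j ∈ s, ((A j).card : ℝ) ≤ D.card := by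
    have h := card_le_card (biUnion_subset.2 hsub : s.biUnion A ⊆ D)
    rw [card_biUnion hdisj] at h
    exact_mod_cast h
  have hsum' : ∑ j ∈ s, ((A j).card : ℝ) ≤ ∑ _j ∈ s, ((D.card : ℝ) / s.card) := by
    rw [sum_const, nsmul_eq_mul, mul_div_cancel₀ _ hspos.ne']
    exact hsum
  exact exists_le_of_sum_le hs hsum'

/-- **Band pigeonhole, weighted form.**  If the finite sets `A j`, `j ∈ s` (`s` nonempty), are pairwise
disjoint subsets of `D` and `w ≥ 0` on `D`, some band has `Σ_{x ∈ A j} w x ≤ (Σ_{x ∈ D} w x) / #s`. -/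
theorem exists_band_weight_le {β ι : Type*} [DecidableEq ι] (s : Finset β) (hs : s.Nonempty)
    (D : Finset ι) (A : β → Finset ι) (hsub : ∀ j ∈ s, A j ⊆ D)
    (hdisj : (s : Set β).PairwiseDisjoint A) (w : ι → ℝ) (hw : ∀ x ∈ D, 0 ≤ w x) :
    ∃ j ∈ s, ∑ x ∈ A j, w x ≤ (∑ x ∈ D, w x) / s.card := by
  have hspos : (0 : ℝ) < s.card := by exact_mod_cast hs.card_pos
  have hsum : ∑ j ∈ s, ∑ x ∈ A j, w x ≤ ∑ x ∈ D, w x := by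
    rw [← sum_biUnion hdisj]
    exact sum_le_sum_of_subset_of_nonneg (biUnion_subset.2 hsub) fun x hx _ => hw x hx
  have hsum' : ∑ j ∈ s, ∑ x ∈ A j, w x ≤ ∑ _j ∈ s, ((∑ x ∈ D, w x) / s.card) := by
    rw [sum_const, nsmul_eq_mul, mul_div_cancel₀ _ hspos.ne']
    exact hsum
  exact exists_le_of_sum_le hs hsum'

end Summit.Ventures.Crystal3D.Theorems
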